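import Summits.QuantumFields.YangMills.Theorems.BalabanUVNodesN15KingModelExactCorrelationLength

/-!
# BalabanUVNodes ∕ N15 — THE KING-MODEL RUNG (PART Ϸ-t): OFF THE AXES — EVENTUAL POSITIVITY AND THE EXACT RATE ALONG EVERY LATTICE RAY:
# `S₂^{ℝ}(z₀ + te_ν) > 0` for all large `t` and `lim_t |S₂^{ℝ}(z₀ + te_ν)|^{1∕t} = e^{−m}` for EVERY base point `z₀ ∈ ℤ^{d+1}` (Track A, DAG node N15 = NE2;
# FAN-OUT v1.1 §N15 s3 «KING-MODEL RUNG»; part Ϸ-e's `limsup ≤ e^{−m}` closed to `=` on every ray, not only on the axes (part Ϸ-j); count-neutral)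

HONEST FRAMING.  Count-neutral (cell `pub-ymgap`, seat `pub-ymgap-dag-n15-e` g34; `--supports stmt-QuantumFields-27366 --as helper` = K3⁸
`SpineGivenEndpointR13SepCoPHV`).  King's `A = 0`, `g = 0` model ([King1986] C. King, Commun. Math. Phys. **102** (1986) 649–677; `S₂^{ℝ}` = the infinite-volume
two-point function of the unit-block averages of the continuum free field of mass `m = √m²`, (4.5) p.670, (4.36) p.674, Thm 3.3 (3.6) p.655).  Off the axes the Laplace
representation of part Ϸ-j carries the SIGNED phase `cos(q·z_⊥)`: `S₂^{ℝ}(z) = (2π)^{−(d+1)}∫P(q)cos(q·z_⊥)A(q)e^{−M_q|z_ν|}dq`.  Splitting `ℝ^d` into the cube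
`C_δ = [−δ,δ]^d` and its complement: on `C_δ`, `|q·z_⊥| ≤ δ‖z_⊥‖₁ ≤ 1` forces `cos ≥ 1∕2`, so the cube contributes at least half of part Ϸ-j's axial cube bound
`∝ e^{−√(m²+dδ′²)|z_ν|}` (`δ′ = δ∕(d+1)`); off `C_δ`, `M_q ≥ √(m²+δ²)` and the contribution is `≥ −G₁e^{−√(m²+δ²)(|z_ν|−1)}` with `G₁ = ∫W₁` the total axial weight at
`t = 1`.  Since `√(m²+dδ′²) < √(m²+δ²)`, the positive term wins for large `|z_ν|`: EVENTUAL POSITIVITY along every ray and `liminf|S₂^{ℝ}(z₀+te_ν)|^{1∕t} ≥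
e^{−√(m²+dδ′²)}` for every small `δ`, hence (with part Ϸ-e's `limsup ≤ e^{−m}`) the LIMIT `e^{−m}` on EVERY lattice ray.  NOT a node discharge (N15 is booked through
n15-a's knit, untouched here); nothing Bałaban ∕ continuum-Yang–Mills ∕ `ℝ⁴` ∕ OS ∕ Clay.  0 `sorry`, 0 def; standard axioms.

WHAT THIS FILE PROVES (kernel).  §1 `abs_phase_le_on_cube`, `half_le_cos_of_abs_le_one`, `sqrt_add_sq_le_massShell_of_not_mem_cube`, `setIntegral_axisWeight_cube_ge`,
`setIntegral_axisWeight_compl_le`, `integrable_phaseKernel`; §2 ★★★ **`kingS2Inf_ge_cube_sub_tail`** (the two-sided lower bound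
`S₂^{ℝ}(z) ≥ (2π)^{−(d+1)}[½(2δ′)^d2^{−d}·2π(cosh m−1)M_{δ′}⁻³e^{−M_{δ′}|z_ν|} − G₁e^{√(m²+δ²)}e^{−√(m²+δ²)|z_ν|}]`); §3 ★★ `kingS2Inf_ray_eventually_pos`, ★★
`le_liminf_rpow_abs_kingS2Inf_ray`, ★★★ **`tendsto_rpow_abs_kingS2Inf_ray`** (`|S₂^{ℝ}(z₀+te_ν)|^{1∕t} → e^{−√m²}` for every `z₀`, `ν`).

HONEST SCOPE.  King's free model, `K = ∞`, infinite volume, lattice rays `z₀ + ℕe_ν`.  N15 untouched; counts unmoved.  Locators (use): [King1986] (4.5) p.670,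
(4.36) p.674, Thm 3.3 (3.6) p.655, Thm 2.1 (2.22) p.654.
-/

noncomputable section

open scoped BigOperators Topology
open Filter MeasureTheory Set

namespace Summit.QuantumFields.YangMills.BalabanUVNodes.N15KingModelRung.OptimalDecay

variable {d : ℕ}

/-! ## §1 Cube ∕ complement estimates -/

/-- On the cube `[−δ,δ]^d`: `|Σ_j q_j w_j| ≤ δ·Σ_j|w_j|`. [folklore] -/
theorem abs_phase_le_on_cube {δ : ℝ} {q : Fin d → ℝ} (hq : q ∈ Icc (fun _ => -δ) (fun _ => δ)) (w : Fin d → ℤ) :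
    |∑ j, q j * (w j : ℝ)| ≤ δ * ∑ j, |(w j : ℝ)| := by
  have hqj : ∀ j, |q j| ≤ δ := fun j => abs_le.mpr ⟨(mem_Icc.mp hq).1 j, (mem_Icc.mp hq).2 j⟩
  calc |∑ j, q j * (w j : ℝ)| ≤ ∑ j, |q j * (w j : ℝ)| := Finset.abs_sum_le_sum_abs _ _
    _ ≤ ∑ j, δ * |(w j : ℝ)| := Finset.sum_le_sum fun j _ => by
        rw [abs_mul]
        exact mul_le_mul_of_nonneg_right (hqj j) (abs_nonneg _)
    _ = δ * ∑ j, |(w j : ℝ)| := by rw [Finset.mul_sum]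

/-- `cos θ ≥ 1∕2` for `|θ| ≤ 1`. [folklore] -/
theorem half_le_cos_of_abs_le_one {θ : ℝ} (h : |θ| ≤ 1) : 1 / 2 ≤ Real.cos θ := by
  have h1 := Real.one_sub_sq_div_two_le_cos (x := θ)
  have h2 : θ ^ 2 ≤ 1 := by
    rw [← sq_abs]
    exact pow_le_one₀ (abs_nonneg _) h
  linarith

/-- Off the cube `[−δ,δ]^d` (`δ ≥ 0`): `M_q ≥ √(m²+δ²)`. [folklore] -/
theorem sqrt_add_sq_le_massShell_of_not_mem_cube {δ m2 : ℝ} (hδ : 0 ≤ δ) {q : Fin d → ℝ} (hq : q ∉ Icc (fun _ => -δ) (fun _ => δ)) :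
    Real.sqrt (m2 + δ ^ 2) ≤ Real.sqrt ((∑ j, q j ^ 2) + m2) := by
  have hq' : ∃ j, δ < |q j| := by
    by_contra hcon
    apply hq
    rw [mem_Icc]
    refine ⟨fun j => ?_, fun j => ?_⟩
    · have := not_exists.mp hcon j
      have := abs_le.mp (not_lt.mp this)
      exact this.1
    · have := not_exists.mp hcon j
      exact (abs_le.mp (not_lt.mp this)).2
  obtain ⟨j, hj⟩ := hq'
  refine Real.sqrt_le_sqrt ?_
  have h1 : δ ^ 2 ≤ q j ^ 2 := by
    rw [← sq_abs (q j)]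
    exact pow_le_pow_left₀ hδ hj.le 2
  have h2 : q j ^ 2 ≤ ∑ i, q i ^ 2 := Finset.single_le_sum (f := fun i => q i ^ 2) (fun i _ => sq_nonneg _) (Finset.mem_univ j)
  linarith

/-- Part Ϸ-j's cube bound as a set-integral statement: for `0 < δ ≤ 1` and `|t| ≥ 1`,
`(2δ)^d·2^{−d}·2π(cosh m − 1)M_δ⁻³e^{−M_δ|t|} ≤ ∫_{[−δ,δ]^d}W_t`, `M_δ = √(dδ²+m²)`. [cite: King1986, (4.5) p.670] -/
theorem setIntegral_axisWeight_cube_ge {m2 δ t : ℝ} (hm : 0 < m2) (hδ : 0 < δ) (hδ1 : δ ≤ 1) (ht : 1 ≤ |t|) :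
    (2 * δ) ^ d * ((1 / 2 : ℝ) ^ d * (2 * Real.pi * (Real.cosh (Real.sqrt m2) - 1) / Real.sqrt (d * δ ^ 2 + m2) ^ 3 * Real.exp (-(Real.sqrt (d * δ ^ 2 + m2) * |t|))))
      ≤ ∫ q in Icc (fun _ : Fin d => -δ) (fun _ : Fin d => δ), (∏ j, Real.sinc (q j / 2) ^ 2) * (2 * Real.pi * (Real.cosh (Real.sqrt ((∑ j, q j ^ 2) + m2)) - 1)
          / Real.sqrt ((∑ j, q j ^ 2) + m2) ^ 3 * Real.exp (-(Real.sqrt ((∑ j, q j ^ 2) + m2) * |t|))) := by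
  have hCvol : volume.real (Icc (fun _ : Fin d => -δ) (fun _ => δ)) = (2 * δ) ^ d := by
    rw [measureReal_def, Real.volume_Icc_pi_toReal (fun _ => by linarith)]
    simp only [sub_neg_eq_add, Finset.prod_const, Finset.card_univ, Fintype.card_fin]
    ring
  have h1 := setIntegral_ge_of_const_le (measurableSet_Icc : MeasurableSet (Icc (fun _ : Fin d => -δ) (fun _ => δ)))
    (isCompact_Icc.measure_lt_top).ne (fun q hq => axisWeight_ge_on_cube hm hδ hδ1 t hq) (integrable_axisWeight hm ht).integrableOn
  rw [hCvol, smul_eq_mul] at h1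
  exact h1

/-- The complement's axial weight is exponentially small at the OFF-cube rate: for `|s| ≥ 1`, `δ ≥ 0`,
`∫_{([−δ,δ]^d)ᶜ}W_s ≤ e^{−√(m²+δ²)(|s|−1)}·∫W_1`. [folklore] -/
theorem setIntegral_axisWeight_compl_le {m2 δ s : ℝ} (hm : 0 < m2) (hδ : 0 ≤ δ) (hs : 1 ≤ |s|) :
    ∫ q in (Icc (fun _ : Fin d => -δ) (fun _ : Fin d => δ))ᶜ, (∏ j, Real.sinc (q j / 2) ^ 2) * (2 * Real.pi * (Real.cosh (Real.sqrt ((∑ j, q j ^ 2) + m2)) - 1)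
          / Real.sqrt ((∑ j, q j ^ 2) + m2) ^ 3 * Real.exp (-(Real.sqrt ((∑ j, q j ^ 2) + m2) * |s|)))
      ≤ Real.exp (-(Real.sqrt (m2 + δ ^ 2) * (|s| - 1))) * ∫ q : Fin d → ℝ, (∏ j, Real.sinc (q j / 2) ^ 2)
          * (2 * Real.pi * (Real.cosh (Real.sqrt ((∑ j, q j ^ 2) + m2)) - 1) / Real.sqrt ((∑ j, q j ^ 2) + m2) ^ 3
              * Real.exp (-(Real.sqrt ((∑ j, q j ^ 2) + m2) * |(1 : ℝ)|))) := by
  have h1 : (1 : ℝ) ≤ |(1 : ℝ)| := by simp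
  have hWs := integrable_axisWeight (d := d) hm hs
  have hW1 := integrable_axisWeight (d := d) hm h1
  -- pointwise on the complement: `W_s ≤ e^{−m_δ(|s|−1)} W_1`
  have hpt : ∀ q ∈ (Icc (fun _ : Fin d => -δ) (fun _ => δ))ᶜ,
      (∏ j, Real.sinc (q j / 2) ^ 2) * (2 * Real.pi * (Real.cosh (Real.sqrt ((∑ j, q j ^ 2) + m2)) - 1) / Real.sqrt ((∑ j, q j ^ 2) + m2) ^ 3
          * Real.exp (-(Real.sqrt ((∑ j, q j ^ 2) + m2) * |s|)))
        ≤ Real.exp (-(Real.sqrt (m2 + δ ^ 2) * (|s| - 1))) * ((∏ j, Real.sinc (q j / 2) ^ 2)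
          * (2 * Real.pi * (Real.cosh (Real.sqrt ((∑ j, q j ^ 2) + m2)) - 1) / Real.sqrt ((∑ j, q j ^ 2) + m2) ^ 3
              * Real.exp (-(Real.sqrt ((∑ j, q j ^ 2) + m2) * |(1 : ℝ)|)))) := by
    intro q hq
    set M := Real.sqrt ((∑ j, q j ^ 2) + m2) with hM
    have hMge : Real.sqrt (m2 + δ ^ 2) ≤ M := sqrt_add_sq_le_massShell_of_not_mem_cube hδ hq
    have hP : 0 ≤ ∏ j, Real.sinc (q j / 2) ^ 2 := Finset.prod_nonneg fun j _ => sq_nonneg _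
    have hc : 0 ≤ Real.cosh M - 1 := by linarith [Real.one_le_cosh M]
    have hw : 0 ≤ 2 * Real.pi * (Real.cosh M - 1) / M ^ 3 := by positivity
    have he : Real.exp (-(M * |s|)) ≤ Real.exp (-(Real.sqrt (m2 + δ ^ 2) * (|s| - 1))) * Real.exp (-(M * |(1 : ℝ)|)) := by
      rw [abs_one, mul_one, ← Real.exp_add]
      refine Real.exp_le_exp.mpr ?_
      have : 0 ≤ |s| - 1 := by linarith
      nlinarith
    calc _ = (∏ j, Real.sinc (q j / 2) ^ 2) * (2 * Real.pi * (Real.cosh M - 1) / M ^ 3) * Real.exp (-(M * |s|)) := by ring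
      _ ≤ (∏ j, Real.sinc (q j / 2) ^ 2) * (2 * Real.pi * (Real.cosh M - 1) / M ^ 3)
            * (Real.exp (-(Real.sqrt (m2 + δ ^ 2) * (|s| - 1))) * Real.exp (-(M * |(1 : ℝ)|))) := mul_le_mul_of_nonneg_left he (mul_nonneg hP hw)
      _ = _ := by ring
  calc _ ≤ ∫ q in (Icc (fun _ : Fin d => -δ) (fun _ => δ))ᶜ, Real.exp (-(Real.sqrt (m2 + δ ^ 2) * (|s| - 1))) * ((∏ j, Real.sinc (q j / 2) ^ 2)
          * (2 * Real.pi * (Real.cosh (Real.sqrt ((∑ j, q j ^ 2) + m2)) - 1) / Real.sqrt ((∑ j, q j ^ 2) + m2) ^ 3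
              * Real.exp (-(Real.sqrt ((∑ j, q j ^ 2) + m2) * |(1 : ℝ)|)))) :=
        setIntegral_mono_on hWs.integrableOn (hW1.const_mul _).integrableOn measurableSet_Icc.compl hpt
    _ = Real.exp (-(Real.sqrt (m2 + δ ^ 2) * (|s| - 1))) * ∫ q in (Icc (fun _ : Fin d => -δ) (fun _ => δ))ᶜ, (∏ j, Real.sinc (q j / 2) ^ 2)
          * (2 * Real.pi * (Real.cosh (Real.sqrt ((∑ j, q j ^ 2) + m2)) - 1) / Real.sqrt ((∑ j, q j ^ 2) + m2) ^ 3
              * Real.exp (-(Real.sqrt ((∑ j, q j ^ 2) + m2) * |(1 : ℝ)|))) := integral_const_mul _ _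
    _ ≤ _ := mul_le_mul_of_nonneg_left (setIntegral_le_integral hW1 (Eventually.of_forall fun q => axisWeight_nonneg m2 1 q)) (Real.exp_pos _).le

/-- The phase kernel `q ↦ P(q)cos(Σ_j q_j w_j)A(q)e^{−M_q|s|}` is integrable (`|s| ≥ 1`). [folklore] -/
theorem integrable_phaseKernel {m2 s : ℝ} (hm : 0 < m2) (hs : 1 ≤ |s|) (w : Fin d → ℤ) :
    Integrable fun q : Fin d → ℝ => (∏ j, Real.sinc (q j / 2) ^ 2) * (Real.cos (∑ j, q j * (w j : ℝ))
        * (2 * Real.pi * (Real.cosh (Real.sqrt ((∑ j, q j ^ 2) + m2)) - 1) / Real.sqrt ((∑ j, q j ^ 2) + m2) ^ 3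
            * Real.exp (-(Real.sqrt ((∑ j, q j ^ 2) + m2) * |s|)))) := by
  have hW := integrable_axisWeight (d := d) hm hs
  have hcont : Continuous fun q : Fin d → ℝ => (∏ j, Real.sinc (q j / 2) ^ 2) * (Real.cos (∑ j, q j * (w j : ℝ))
      * (2 * Real.pi * (Real.cosh (Real.sqrt ((∑ j, q j ^ 2) + m2)) - 1) / Real.sqrt ((∑ j, q j ^ 2) + m2) ^ 3
          * Real.exp (-(Real.sqrt ((∑ j, q j ^ 2) + m2) * |s|)))) := by
    have hM : ∀ q : Fin d → ℝ, Real.sqrt ((∑ j, q j ^ 2) + m2) ^ 3 ≠ 0 := fun q => by positivity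
    exact Continuous.mul (by fun_prop) (Continuous.mul (by fun_prop) (Continuous.mul (Continuous.div (by fun_prop) (by fun_prop) hM) (by fun_prop)))
  refine hW.mono' hcont.aestronglyMeasurable (Eventually.of_forall fun q => ?_)
  have h0 := axisWeight_nonneg m2 s q
  rw [Real.norm_eq_abs]
  have hP : 0 ≤ ∏ j, Real.sinc (q j / 2) ^ 2 := Finset.prod_nonneg fun j _ => sq_nonneg _
  have hc : 0 ≤ Real.cosh (Real.sqrt ((∑ j, q j ^ 2) + m2)) - 1 := by linarith [Real.one_le_cosh (Real.sqrt ((∑ j, q j ^ 2) + m2))]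
  have hA : 0 ≤ 2 * Real.pi * (Real.cosh (Real.sqrt ((∑ j, q j ^ 2) + m2)) - 1) / Real.sqrt ((∑ j, q j ^ 2) + m2) ^ 3
      * Real.exp (-(Real.sqrt ((∑ j, q j ^ 2) + m2) * |s|)) := by positivity
  rw [show (∏ j, Real.sinc (q j / 2) ^ 2) * (Real.cos (∑ j, q j * (w j : ℝ)) * (2 * Real.pi * (Real.cosh (Real.sqrt ((∑ j, q j ^ 2) + m2)) - 1)
      / Real.sqrt ((∑ j, q j ^ 2) + m2) ^ 3 * Real.exp (-(Real.sqrt ((∑ j, q j ^ 2) + m2) * |s|))))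
      = Real.cos (∑ j, q j * (w j : ℝ)) * ((∏ j, Real.sinc (q j / 2) ^ 2) * (2 * Real.pi * (Real.cosh (Real.sqrt ((∑ j, q j ^ 2) + m2)) - 1)
      / Real.sqrt ((∑ j, q j ^ 2) + m2) ^ 3 * Real.exp (-(Real.sqrt ((∑ j, q j ^ 2) + m2) * |s|)))) by ring, abs_mul, abs_of_nonneg h0]
  calc _ ≤ 1 * _ := mul_le_mul_of_nonneg_right (Real.abs_cos_le_one _) h0
    _ = _ := one_mul _

/-! ## §2 The two-sided lower bound off the axes -/

/-- ★★★ **THE CUBE-MINUS-TAIL LOWER BOUND**: for `|z_ν| ≥ 1`, `0 < δ ≤ 1` with `δ·‖z_⊥‖₁ ≤ 1`, and `δ′ = δ∕(d+1)`,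
`S₂^{ℝ}(z) ≥ (2π)^{−(d+1)}·[½·(2δ′)^d2^{−d}·2π(cosh m − 1)M_{δ′}⁻³e^{−M_{δ′}|z_ν|} − e^{−√(m²+δ²)(|z_ν|−1)}·∫W₁]`, `M_{δ′} = √(dδ′²+m²)` (cube: `cos ≥ ½`; tail:
`cos ≥ −1` and `M_q ≥ √(m²+δ²)`). [cite: King1986, (4.5) p.670, (4.36) p.674, Thm 3.3 (3.6) p.655] -/
theorem kingS2Inf_ge_cube_sub_tail {m2 δ : ℝ} (hm : 0 < m2) (hδ : 0 < δ) (hδ1 : δ ≤ 1) (z : Fin (d + 1) → ℤ) (ν : Fin (d + 1))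
    (hz : 1 ≤ |(z ν : ℝ)|) (hδW : δ * ∑ j, |(z (ν.succAbove j) : ℝ)| ≤ 1) :
    ((2 * Real.pi) ^ (d + 1))⁻¹ * ((1 / 2) * ((2 * (δ / (d + 1))) ^ d * ((1 / 2 : ℝ) ^ d
        * (2 * Real.pi * (Real.cosh (Real.sqrt m2) - 1) / Real.sqrt (d * (δ / (d + 1)) ^ 2 + m2) ^ 3
            * Real.exp (-(Real.sqrt (d * (δ / (d + 1)) ^ 2 + m2) * |(z ν : ℝ)|)))))
      - Real.exp (-(Real.sqrt (m2 + δ ^ 2) * (|(z ν : ℝ)| - 1))) * ∫ q : Fin d → ℝ, (∏ j, Real.sinc (q j / 2) ^ 2)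
          * (2 * Real.pi * (Real.cosh (Real.sqrt ((∑ j, q j ^ 2) + m2)) - 1) / Real.sqrt ((∑ j, q j ^ 2) + m2) ^ 3
              * Real.exp (-(Real.sqrt ((∑ j, q j ^ 2) + m2) * |(1 : ℝ)|))))
      ≤ kingS2Inf m2 z := by
  rw [kingS2Inf_eq_integral_exp hm z ν hz]
  refine mul_le_mul_of_nonneg_left ?_ (by positivity)
  -- the phase kernel `f`, the axial weight `g` at `s = z_ν`, the cube `C`
  set s : ℝ := (z ν : ℝ) with hsdef
  set w : Fin d → ℤ := fun j => z (ν.succAbove j) with hwdef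
  set g : (Fin d → ℝ) → ℝ := fun q => (∏ j, Real.sinc (q j / 2) ^ 2) * (2 * Real.pi * (Real.cosh (Real.sqrt ((∑ j, q j ^ 2) + m2)) - 1)
      / Real.sqrt ((∑ j, q j ^ 2) + m2) ^ 3 * Real.exp (-(Real.sqrt ((∑ j, q j ^ 2) + m2) * |s|))) with hgdef
  set f : (Fin d → ℝ) → ℝ := fun q => (∏ j, Real.sinc (q j / 2) ^ 2) * (Real.cos (∑ j, q j * (w j : ℝ))
      * (2 * Real.pi * (Real.cosh (Real.sqrt ((∑ j, q j ^ 2) + m2)) - 1) / Real.sqrt ((∑ j, q j ^ 2) + m2) ^ 3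
          * Real.exp (-(Real.sqrt ((∑ j, q j ^ 2) + m2) * |s|)))) with hfdef
  set C : Set (Fin d → ℝ) := Icc (fun _ : Fin d => -δ) (fun _ : Fin d => δ) with hCdef
  have hfg : ∀ q, f q = Real.cos (∑ j, q j * (w j : ℝ)) * g q := fun q => by simp only [hfdef, hgdef]; ring
  have hg0 : ∀ q, 0 ≤ g q := fun q => axisWeight_nonneg m2 s q
  have hgi : Integrable g := integrable_axisWeight hm hz
  have hfi : Integrable f := integrable_phaseKernel hm hz w
  have hC : MeasurableSet C := measurableSet_Icc
  -- split `∫ f = ∫_C f + ∫_{Cᶜ} f`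
  have hsplit : ∫ q, f q = (∫ q in C, f q) + ∫ q in Cᶜ, f q := (integral_add_compl hC hfi).symm
  -- the cube: `∫_C f ≥ ½ ∫_C g ≥ ½ ∫_{C_{δ′}} g ≥ ½ · (cube bound at δ′)`
  have hcube1 : (1 / 2) * ∫ q in C, g q ≤ ∫ q in C, f q := by
    rw [← integral_const_mul]
    refine setIntegral_mono_on (hgi.const_mul _).integrableOn hfi.integrableOn hC fun q hq => ?_
    rw [hfg q]
    refine mul_le_mul_of_nonneg_right ?_ (hg0 q)
    refine half_le_cos_of_abs_le_one ((abs_phase_le_on_cube hq w).trans ?_)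
    simpa [hwdef] using hδW
  have hδ' : 0 < δ / (d + 1) := by positivity
  have hδ'le : δ / (d + 1) ≤ δ := div_le_self hδ.le (by norm_cast; omega)
  have hδ'1 : δ / (d + 1) ≤ 1 := hδ'le.trans hδ1
  have hcube2 : ∫ q in Icc (fun _ : Fin d => -(δ / (d + 1))) (fun _ : Fin d => δ / (d + 1)), g q ≤ ∫ q in C, g q := by
    refine setIntegral_mono_set hgi.integrableOn (Eventually.of_forall hg0) (Eventually.of_forall ?_)
    exact Icc_subset_Icc (fun _ => by simpa using hδ'le) (fun _ => hδ'le)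
  have hcube3 := setIntegral_axisWeight_cube_ge (d := d) hm hδ' hδ'1 hz
  -- the tail: `∫_{Cᶜ} f ≥ −∫_{Cᶜ} g ≥ −e^{−m_δ(|s|−1)}∫g₁`
  have htail1 : -(∫ q in Cᶜ, g q) ≤ ∫ q in Cᶜ, f q := by
    rw [← integral_neg]
    refine setIntegral_mono_on hgi.neg.integrableOn hfi.integrableOn hC.compl fun q _ => ?_
    rw [hfg q]
    have := Real.neg_one_le_cos (∑ j, q j * (w j : ℝ))
    nlinarith [hg0 q]
  have htail2 := setIntegral_axisWeight_compl_le (d := d) hm hδ.le hz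
  rw [hsplit]
  linarith [hcube1, hcube2, hcube3, htail1, htail2]

/-! ## §3 Along a lattice ray `z₀ + te_ν` -/

/-- The `⊥`-coordinates are constant along the ray: `(z₀ + te_ν)_{ν↑j} = (z₀)_{ν↑j}`. [folklore] -/
theorem ray_apply_succAbove (z₀ : Fin (d + 1) → ℤ) (ν : Fin (d + 1)) (t : ℕ) (j : Fin d) :
    (z₀ + (t : ℤ) • (Pi.single ν (1 : ℤ) : Fin (d + 1) → ℤ)) (ν.succAbove j) = z₀ (ν.succAbove j) := by
  simp

/-- ★★ **EVENTUAL EXPONENTIAL LOWER BOUND ALONG EVERY RAY**: for `0 < δ ≤ 1` with `δ‖(z₀)_⊥‖₁ ≤ 1` there is `A > 0` with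
`A·e^{−√(m²+d(δ∕(d+1))²)·t} ≤ S₂^{ℝ}(z₀ + te_ν)` for all large `t`. [cite: King1986, (4.5) p.670, Thm 3.3 (3.6) p.655] -/
theorem kingS2Inf_ray_eventually_ge {m2 δ : ℝ} (hm : 0 < m2) (hδ : 0 < δ) (hδ1 : δ ≤ 1) (z₀ : Fin (d + 1) → ℤ) (ν : Fin (d + 1))
    (hδW : δ * ∑ j, |(z₀ (ν.succAbove j) : ℝ)| ≤ 1) :
    ∃ A : ℝ, 0 < A ∧ ∀ᶠ t : ℕ in atTop,
      A * Real.exp (-(Real.sqrt (d * (δ / (d + 1)) ^ 2 + m2) * t)) ≤ kingS2Inf m2 (z₀ + (t : ℤ) • (Pi.single ν (1 : ℤ) : Fin (d + 1) → ℤ)) := by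
  set a : ℝ := Real.sqrt (d * (δ / (d + 1)) ^ 2 + m2) with ha
  set b : ℝ := Real.sqrt (m2 + δ ^ 2) with hb
  set c₀ : ℝ := (z₀ ν : ℝ) with hc₀
  set G₁ : ℝ := ∫ q : Fin d → ℝ, (∏ j, Real.sinc (q j / 2) ^ 2)
      * (2 * Real.pi * (Real.cosh (Real.sqrt ((∑ j, q j ^ 2) + m2)) - 1) / Real.sqrt ((∑ j, q j ^ 2) + m2) ^ 3
          * Real.exp (-(Real.sqrt ((∑ j, q j ^ 2) + m2) * |(1 : ℝ)|))) with hG₁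
  set L : ℝ := ((2 * Real.pi) ^ (d + 1))⁻¹ * ((1 / 2) * ((2 * (δ / (d + 1))) ^ d * ((1 / 2 : ℝ) ^ d
      * (2 * Real.pi * (Real.cosh (Real.sqrt m2) - 1) / a ^ 3)))) with hL
  have hm' : 0 < Real.sqrt m2 := Real.sqrt_pos.mpr hm
  have hcm : 0 < Real.cosh (Real.sqrt m2) - 1 := by linarith [Real.one_lt_cosh.mpr hm'.ne']
  have ha0 : 0 < a := Real.sqrt_pos.mpr (by positivity)
  have hL0 : 0 < L := by positivity
  have hG0 : 0 ≤ G₁ := integral_nonneg fun q => axisWeight_nonneg m2 1 q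
  have hab : a < b := by
    rw [ha, hb]
    refine Real.sqrt_lt_sqrt (by positivity) ?_
    have hd : (d : ℝ) * (δ / (d + 1)) ^ 2 < δ ^ 2 := by
      rw [div_pow, mul_div_assoc']
      rw [div_lt_iff₀ (by positivity)]
      have : (d : ℝ) < (d + 1) ^ 2 := by nlinarith [(Nat.cast_nonneg d : (0 : ℝ) ≤ d)]
      nlinarith [pow_pos hδ 2]
    linarith
  set A : ℝ := L * Real.exp (-(a * c₀)) with hA
  set B : ℝ := Real.exp (-(b * (c₀ - 1))) * ((2 * Real.pi) ^ (d + 1))⁻¹ * G₁ with hB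
  have hA0 : 0 < A := by positivity
  have hB0 : 0 ≤ B := by positivity
  refine ⟨A / 2, by positivity, ?_⟩
  have hlow : ∀ t : ℕ, (z₀ ν).natAbs + 1 ≤ t →
      A * Real.exp (-(a * t)) - B * Real.exp (-(b * t)) ≤ kingS2Inf m2 (z₀ + (t : ℤ) • (Pi.single ν (1 : ℤ) : Fin (d + 1) → ℤ)) := by
    intro t ht
    set z := z₀ + (t : ℤ) • (Pi.single ν (1 : ℤ) : Fin (d + 1) → ℤ) with hz
    have hzν : (z ν : ℝ) = c₀ + t := by rw [hz, ray_apply]; push_cast; rw [hc₀]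
    have hs1 : 1 ≤ c₀ + t := by
      have h1 : ((z₀ ν).natAbs : ℝ) + 1 ≤ t := by exact_mod_cast ht
      have h2 : -c₀ ≤ ((z₀ ν).natAbs : ℝ) := by
        rw [Nat.cast_natAbs, Int.cast_abs]
        exact neg_le_abs _
      linarith
    have hzabs : |(z ν : ℝ)| = c₀ + t := by rw [hzν, abs_of_pos (by linarith)]
    have hz1 : 1 ≤ |(z ν : ℝ)| := by rw [hzabs]; exact hs1
    have hW : δ * ∑ j, |(z (ν.succAbove j) : ℝ)| ≤ 1 := by
      simp only [hz, ray_apply_succAbove]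
      exact hδW
    have h := kingS2Inf_ge_cube_sub_tail hm hδ hδ1 z ν hz1 hW
    rw [hzabs] at h
    refine le_trans (le_of_eq ?_) h
    rw [hA, hB, hL, hG₁, ha, hb]
    have e1 : Real.exp (-(Real.sqrt (d * (δ / (d + 1)) ^ 2 + m2) * (c₀ + t)))
        = Real.exp (-(Real.sqrt (d * (δ / (d + 1)) ^ 2 + m2) * c₀)) * Real.exp (-(Real.sqrt (d * (δ / (d + 1)) ^ 2 + m2) * t)) := by
      rw [← Real.exp_add]; congr 1; ring
    have e2 : Real.exp (-(Real.sqrt (m2 + δ ^ 2) * (c₀ + t - 1)))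
        = Real.exp (-(Real.sqrt (m2 + δ ^ 2) * (c₀ - 1))) * Real.exp (-(Real.sqrt (m2 + δ ^ 2) * t)) := by
      rw [← Real.exp_add]; congr 1; ring
    rw [e1, e2]
    ring
  have hgap : Tendsto (fun t : ℕ => B * Real.exp (-((b - a) * t))) atTop (𝓝 (B * 0)) := by
    refine Tendsto.const_mul B ?_
    have h1 : Tendsto (fun t : ℕ => (b - a) * (t : ℝ)) atTop atTop :=
      Tendsto.const_mul_atTop (by linarith) tendsto_natCast_atTop_atTop
    exact Real.tendsto_exp_neg_atTop_nhds_zero.comp h1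
  rw [mul_zero] at hgap
  have hev : ∀ᶠ t : ℕ in atTop, B * Real.exp (-((b - a) * t)) < A / 2 := (tendsto_order.1 hgap).2 _ (by positivity)
  filter_upwards [hev, eventually_ge_atTop ((z₀ ν).natAbs + 1)] with t ht1 ht2
  have h := hlow t ht2
  have e3 : B * Real.exp (-(b * t)) = B * Real.exp (-((b - a) * t)) * Real.exp (-(a * t)) := by
    rw [show -(b * (t : ℝ)) = -((b - a) * t) + -(a * t) by ring, Real.exp_add]
    ring
  rw [e3] at h
  nlinarith [Real.exp_pos (-(a * t)), ht1]

/-- ★★ **EVENTUAL POSITIVITY ALONG EVERY RAY**: `S₂^{ℝ}(z₀ + te_ν) > 0` for all large `t`, every `z₀`, `ν`. [cite: King1986, (4.5) p.670, Thm 3.3 (3.6) p.655] -/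
theorem kingS2Inf_ray_eventually_pos {m2 : ℝ} (hm : 0 < m2) (z₀ : Fin (d + 1) → ℤ) (ν : Fin (d + 1)) :
    ∀ᶠ t : ℕ in atTop, 0 < kingS2Inf m2 (z₀ + (t : ℤ) • (Pi.single ν (1 : ℤ) : Fin (d + 1) → ℤ)) := by
  set W : ℝ := ∑ j, |(z₀ (ν.succAbove j) : ℝ)| with hW
  have hW0 : 0 ≤ W := Finset.sum_nonneg fun j _ => abs_nonneg _
  have hδ : 0 < 1 / (W + 1) := by positivity
  have hδ1 : 1 / (W + 1) ≤ 1 := by rw [div_le_one (by positivity)]; linarith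
  have hδW : 1 / (W + 1) * W ≤ 1 := by rw [div_mul_eq_mul_div, one_mul, div_le_one (by positivity)]; linarith
  obtain ⟨A, hA, hev⟩ := kingS2Inf_ray_eventually_ge hm hδ hδ1 z₀ ν hδW
  filter_upwards [hev] with t ht
  exact lt_of_lt_of_le (by positivity) ht

/-- ★★ For every `0 < δ ≤ 1` with `δ‖(z₀)_⊥‖₁ ≤ 1`: `liminf_t |S₂^{ℝ}(z₀+te_ν)|^{1∕t} ≥ e^{−√(m²+d(δ∕(d+1))²)}`. [cite: King1986, Thm 3.3 (3.6) p.655] -/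
theorem liminf_rpow_abs_kingS2Inf_ray_ge {m2 δ : ℝ} (hm : 0 < m2) (hδ : 0 < δ) (hδ1 : δ ≤ 1) (z₀ : Fin (d + 1) → ℤ) (ν : Fin (d + 1))
    (hδW : δ * ∑ j, |(z₀ (ν.succAbove j) : ℝ)| ≤ 1) :
    Real.exp (-Real.sqrt (d * (δ / (d + 1)) ^ 2 + m2))
      ≤ liminf (fun t : ℕ => |kingS2Inf m2 (z₀ + (t : ℤ) • (Pi.single ν (1 : ℤ) : Fin (d + 1) → ℤ))| ^ ((t : ℝ)⁻¹)) atTop := by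
  set a : ℝ := Real.sqrt (d * (δ / (d + 1)) ^ 2 + m2) with ha
  obtain ⟨A, hA, hev⟩ := kingS2Inf_ray_eventually_ge hm hδ hδ1 z₀ ν hδW
  have hlow : ∀ᶠ t : ℕ in atTop, A ^ ((t : ℝ)⁻¹) * Real.exp (-a)
      ≤ |kingS2Inf m2 (z₀ + (t : ℤ) • (Pi.single ν (1 : ℤ) : Fin (d + 1) → ℤ))| ^ ((t : ℝ)⁻¹) := by
    filter_upwards [hev, eventually_ge_atTop 1] with t ht ht1
    have ht0 : (0 : ℝ) < t := by exact_mod_cast ht1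
    have hpos : 0 ≤ A * Real.exp (-(a * t)) := by positivity
    have hle : A * Real.exp (-(a * t)) ≤ |kingS2Inf m2 (z₀ + (t : ℤ) • (Pi.single ν (1 : ℤ) : Fin (d + 1) → ℤ))| := ht.trans (le_abs_self _)
    have hr := Real.rpow_le_rpow hpos hle (inv_nonneg.mpr ht0.le)
    refine le_trans (le_of_eq ?_) hr
    rw [Real.mul_rpow hA.le (Real.exp_pos _).le, ← Real.exp_mul]
    congr 2
    field_simp
  have hg : Tendsto (fun t : ℕ => A ^ ((t : ℝ)⁻¹) * Real.exp (-a)) atTop (𝓝 (Real.exp (-a))) := by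
    have h : (fun t : ℕ => A ^ ((t : ℝ)⁻¹)) = fun t : ℕ => Real.exp (Real.log A / (t : ℝ)) := by
      funext t
      rw [Real.rpow_def_of_pos hA, div_eq_mul_inv]
    have h1 : Tendsto (fun t : ℕ => A ^ ((t : ℝ)⁻¹)) atTop (𝓝 1) := by
      rw [h, ← Real.exp_zero]
      exact (Real.continuous_exp.tendsto 0).comp (tendsto_const_div_atTop_nhds_zero_nat _)
    have := h1.mul_const (Real.exp (-a))
    rwa [one_mul] at this
  rw [← hg.liminf_eq]
  refine liminf_le_liminf hlow hg.isBoundedUnder_ge ?_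
  refine isCoboundedUnder_ge_of_eventually_le atTop (x := max 1 m2⁻¹) ?_
  filter_upwards [eventually_ge_atTop 1] with t ht
  have ht0 : (0 : ℝ) < t := by exact_mod_cast ht
  have hb := abs_kingS2Inf_le hm (z₀ + (t : ℤ) • (Pi.single ν (1 : ℤ) : Fin (d + 1) → ℤ))
  have h1 : |kingS2Inf m2 (z₀ + (t : ℤ) • (Pi.single ν (1 : ℤ) : Fin (d + 1) → ℤ))| ^ ((t : ℝ)⁻¹) ≤ (max 1 m2⁻¹) ^ ((t : ℝ)⁻¹) :=
    Real.rpow_le_rpow (abs_nonneg _) (hb.trans (le_max_right _ _)) (inv_nonneg.mpr ht0.le)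
  refine h1.trans ?_
  calc (max 1 m2⁻¹) ^ ((t : ℝ)⁻¹) ≤ (max 1 m2⁻¹) ^ (1 : ℝ) :=
        Real.rpow_le_rpow_of_exponent_le (le_max_left _ _) (inv_le_one_of_one_le₀ (by exact_mod_cast ht))
    _ = max 1 m2⁻¹ := Real.rpow_one _

/-- ★★ `liminf_t |S₂^{ℝ}(z₀+te_ν)|^{1∕t} ≥ e^{−√m²}` for every base point (let `δ → 0⁺`). [cite: King1986, Thm 3.3 (3.6) p.655] -/
theorem le_liminf_rpow_abs_kingS2Inf_ray {m2 : ℝ} (hm : 0 < m2) (z₀ : Fin (d + 1) → ℤ) (ν : Fin (d + 1)) :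
    Real.exp (-Real.sqrt m2) ≤ liminf (fun t : ℕ => |kingS2Inf m2 (z₀ + (t : ℤ) • (Pi.single ν (1 : ℤ) : Fin (d + 1) → ℤ))| ^ ((t : ℝ)⁻¹)) atTop := by
  set W : ℝ := ∑ j, |(z₀ (ν.succAbove j) : ℝ)| with hW
  have hW0 : 0 ≤ W := Finset.sum_nonneg fun j _ => abs_nonneg _
  have hδn : ∀ n : ℕ, 0 < 1 / ((W + 1) * ((n : ℝ) + 1)) := fun n => by positivity
  have hδn1 : ∀ n : ℕ, 1 / ((W + 1) * ((n : ℝ) + 1)) ≤ 1 := fun n => by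
    rw [div_le_one (by positivity)]
    nlinarith [(Nat.cast_nonneg n : (0 : ℝ) ≤ n)]
  have hδnW : ∀ n : ℕ, 1 / ((W + 1) * ((n : ℝ) + 1)) * W ≤ 1 := fun n => by
    rw [div_mul_eq_mul_div, one_mul, div_le_one (by positivity)]
    nlinarith [(Nat.cast_nonneg n : (0 : ℝ) ≤ n)]
  have hlimδ : Tendsto (fun n : ℕ => 1 / ((W + 1) * ((n : ℝ) + 1))) atTop (𝓝 0) := by
    have h1 : Tendsto (fun n : ℕ => (W + 1) * ((n : ℝ) + 1)) atTop atTop :=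
      Tendsto.const_mul_atTop (by positivity) (tendsto_natCast_atTop_atTop.atTop_add tendsto_const_nhds)
    exact tendsto_const_nhds.div_atTop h1
  have hcont : Continuous fun δ : ℝ => Real.exp (-Real.sqrt (d * (δ / (d + 1)) ^ 2 + m2)) := by fun_prop
  have hlim : Tendsto (fun n : ℕ => Real.exp (-Real.sqrt (d * ((1 / ((W + 1) * ((n : ℝ) + 1))) / (d + 1)) ^ 2 + m2))) atTop
      (𝓝 (Real.exp (-Real.sqrt m2))) := by
    have h := (hcont.tendsto 0).comp hlimδ
    simp only [Function.comp_def, zero_div, ne_eq, OfNat.ofNat_ne_zero, not_false_eq_true, zero_pow, mul_zero, zero_add] at h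
    exact h
  refine le_of_tendsto hlim (Eventually.of_forall fun n => ?_)
  exact liminf_rpow_abs_kingS2Inf_ray_ge hm (hδn n) (hδn1 n) z₀ ν (hδnW n)

/-- ★★★ **THE EXACT RATE ALONG EVERY LATTICE RAY**: for `m² > 0`, every base point `z₀ ∈ ℤ^{d+1}` and every direction `ν`,
`lim_{t→∞} |S₂^{ℝ}(z₀ + te_ν)|^{1∕t} = e^{−√m²}` (part Ϸ-e's `limsup ≤`, this file's `liminf ≥`). [cite: King1986, Thm 3.3 (3.6) p.655, Thm 2.1 (2.22) p.654] -/
theorem tendsto_rpow_abs_kingS2Inf_ray {m2 : ℝ} (hm : 0 < m2) (z₀ : Fin (d + 1) → ℤ) (ν : Fin (d + 1)) :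
    Tendsto (fun t : ℕ => |kingS2Inf m2 (z₀ + (t : ℤ) • (Pi.single ν (1 : ℤ) : Fin (d + 1) → ℤ))| ^ ((t : ℝ)⁻¹)) atTop (𝓝 (Real.exp (-Real.sqrt m2))) := by
  refine tendsto_of_le_liminf_of_limsup_le (le_liminf_rpow_abs_kingS2Inf_ray hm z₀ ν) (limsup_rpow_abs_kingS2Inf_ray_le hm z₀ ν) ?_ ?_
  · refine isBoundedUnder_of_eventually_le (f := atTop) (a := max 1 m2⁻¹) ?_
    filter_upwards [eventually_ge_atTop 1] with t ht
    have ht0 : (0 : ℝ) < t := by exact_mod_cast ht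
    have hb := abs_kingS2Inf_le hm (z₀ + (t : ℤ) • (Pi.single ν (1 : ℤ) : Fin (d + 1) → ℤ))
    have h1 : |kingS2Inf m2 (z₀ + (t : ℤ) • (Pi.single ν (1 : ℤ) : Fin (d + 1) → ℤ))| ^ ((t : ℝ)⁻¹) ≤ (max 1 m2⁻¹) ^ ((t : ℝ)⁻¹) :=
      Real.rpow_le_rpow (abs_nonneg _) (hb.trans (le_max_right _ _)) (inv_nonneg.mpr ht0.le)
    refine h1.trans ?_
    calc (max 1 m2⁻¹) ^ ((t : ℝ)⁻¹) ≤ (max 1 m2⁻¹) ^ (1 : ℝ) :=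
          Real.rpow_le_rpow_of_exponent_le (le_max_left _ _) (inv_le_one_of_one_le₀ (by exact_mod_cast ht))
      _ = max 1 m2⁻¹ := Real.rpow_one _
  · exact isBoundedUnder_of_eventually_ge (f := atTop) (a := 0) (Eventually.of_forall fun t => Real.rpow_nonneg (abs_nonneg _) _)

end Summit.QuantumFields.YangMills.BalabanUVNodes.N15KingModelRung.OptimalDecay
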